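import Summits.MatrixMultiplication.OmegaCensus.SmallFormats.KroneckerChains

/-!
# Kronecker modules VI-a: block types, block decompositions, assembly

Cell `pub-omega` (unit `pub-omega-tensor-g33`), topic `Summits/MatrixMultiplication/OmegaCensus` (sub-folder `SmallFormats`).
Framing (verbatim): lottery ticket; floor = certified bounds/negative ranges. HONEST FRAMING: general linear algebra toward
PROVING `KroneckerBlockForm97`; nothing on `ω` here.

`KBlock k` = the Weierstraß–Kronecker block types over a field `k` with EXACTLY the conventions of `PBlock`
(`MatMul227GF3FootprintBlocks`, tensor g32): `L e` (`e × (e+1)`, `A = [I|0]`, `B = [0|I]`), `LT e` (`(e+1) × e`), `N u`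
(`A = I`, `B` = upper shift), `C c` (`B = I`, `A` = companion matrix of `X^D + Σ cᵢ Xⁱ`: subdiagonal ones, last column
`-cᵢ`). A *block decomposition* of a Kronecker module `a b : U →ₗ[k] V` (`IsBlockDecomposition`) is a finite list of
blocks with row vectors `e i r ∈ U` and column vectors `f i c ∈ V` such that `Σ rows = finrank U`, `Σ cols = finrank V`,
the `e i r` span `U`, the `f i c` span `V`, and `a (e i r) = Σ_c A r c • f i c`, `b (e i r) = Σ_c B r c • f i c` — i.e.
the pencil has block-diagonal matrix in these bases. This file: decompositions of invariant complements ASSEMBLE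
(`IsBlockDecomposition.append`), a single block is a decomposition (`IsBlockDecomposition.single`), reindexing, the zero
module.
-/

namespace Summit.MatrixMultiplication.OmegaCensus.SmallFormats.Kronecker

open Module Submodule

/-- Weierstraß–Kronecker block types over a field (conventions of `PBlock`). -/
inductive KBlock (k : Type*) where
  | L (e : ℕ)
  | LT (e : ℕ)
  | N (u : ℕ)
  | C (c : List k)

namespace KBlock

variable {k : Type*} [Field k]

/-- Number of rows (vectors on the `U` side). -/
def rows : KBlock k → ℕ
  | L e => e
  | LT e => e + 1
  | N u => u
  | C c => c.length

/-- Number of columns (vectors on the `V` side). -/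
def cols : KBlock k → ℕ
  | L e => e + 1
  | LT e => e
  | N u => u
  | C c => c.length

/-- Entry `(i, j)` of the `A`-part of a block. -/
def A : KBlock k → ℕ → ℕ → k
  | L _, i, j => if j = i then 1 else 0
  | LT _, i, j => if j = i then 1 else 0
  | N _, i, j => if j = i then 1 else 0
  | C c, i, j => if j + 1 = c.length then -c.getD i 0 else if i = j + 1 then 1 else 0

/-- Entry `(i, j)` of the `B`-part of a block. -/
def B : KBlock k → ℕ → ℕ → k
  | L _, i, j => if j = i + 1 then 1 else 0
  | LT _, i, j => if j + 1 = i then 1 else 0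
  | N _, i, j => if j = i + 1 then 1 else 0
  | C _, i, j => if j = i then 1 else 0

end KBlock

variable {k : Type*} [Field k] {U V : Type*} [AddCommGroup U] [Module k U] [AddCommGroup V] [Module k V]

/-- A *block decomposition* of the Kronecker module `(a, b)`: blocks `blk i`, row vectors `e i r` (`r < rows`), column
vectors `f i c` (`c < cols`) spanning `U` and `V` in the right number, with the block relations. -/
structure IsBlockDecomposition (a b : U →ₗ[k] V) {n : ℕ} (blk : Fin n → KBlock k) (e : Fin n → ℕ → U)
    (f : Fin n → ℕ → V) : Prop where
  rows_eq : ∑ i, (blk i).rows = finrank k U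
  cols_eq : ∑ i, (blk i).cols = finrank k V
  span_e : ∀ u : U, ∃ g : Fin n → ℕ → k, u = ∑ i, ∑ r ∈ Finset.range (blk i).rows, g i r • e i r
  span_f : ∀ v : V, ∃ g : Fin n → ℕ → k, v = ∑ i, ∑ c ∈ Finset.range (blk i).cols, g i c • f i c
  rel_a : ∀ i, ∀ r < (blk i).rows, a (e i r) = ∑ c ∈ Finset.range (blk i).cols, (blk i).A r c • f i c
  rel_b : ∀ i, ∀ r < (blk i).rows, b (e i r) = ∑ c ∈ Finset.range (blk i).cols, (blk i).B r c • f i c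

namespace IsBlockDecomposition

variable {a b : U →ₗ[k] V}

/-- Reindexing the blocks along a permutation. -/
theorem reindex {n : ℕ} {blk : Fin n → KBlock k} {e : Fin n → ℕ → U} {f : Fin n → ℕ → V}
    (D : IsBlockDecomposition a b blk e f) (σ : Fin n ≃ Fin n) :
    IsBlockDecomposition a b (blk ∘ σ) (e ∘ σ) (f ∘ σ) := by
  refine ⟨?_, ?_, fun u => ?_, fun v => ?_, fun i r hr => D.rel_a (σ i) r hr, fun i r hr => D.rel_b (σ i) r hr⟩
  · rw [← D.rows_eq]; exact Equiv.sum_comp σ (fun i => (blk i).rows)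
  · rw [← D.cols_eq]; exact Equiv.sum_comp σ (fun i => (blk i).cols)
  · obtain ⟨g, hg⟩ := D.span_e u
    refine ⟨g ∘ σ, ?_⟩
    rw [hg]
    exact (Equiv.sum_comp σ (fun i => ∑ r ∈ Finset.range (blk i).rows, g i r • e i r)).symm
  · obtain ⟨g, hg⟩ := D.span_f v
    refine ⟨g ∘ σ, ?_⟩
    rw [hg]
    exact (Equiv.sum_comp σ (fun i => ∑ c ∈ Finset.range (blk i).cols, g i c • f i c)).symm

/-- The zero module has the empty block decomposition. -/
theorem empty [FiniteDimensional k U] [FiniteDimensional k V] (hU : finrank k U = 0) (hV : finrank k V = 0) :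
    IsBlockDecomposition a b (n := 0) Fin.elim0 Fin.elim0 Fin.elim0 := by
  refine ⟨by simp [hU], by simp [hV], fun u => ⟨Fin.elim0, ?_⟩, fun v => ⟨Fin.elim0, ?_⟩, fun i => i.elim0, fun i => i.elim0⟩
  · rw [finrank_zero_iff_forall_zero.mp hU u]; simp
  · rw [finrank_zero_iff_forall_zero.mp hV v]; simp

/-- **Assembly.** Block decompositions of two complementary invariant pairs give a block decomposition of the module. -/
theorem append [FiniteDimensional k U] [FiniteDimensional k V] {U₁ U₂ : Submodule k U} {V₁ V₂ : Submodule k V}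
    (hU : IsCompl U₁ U₂) (hV : IsCompl V₁ V₂)
    {h1a : ∀ u ∈ U₁, a u ∈ V₁} {h1b : ∀ u ∈ U₁, b u ∈ V₁} {h2a : ∀ u ∈ U₂, a u ∈ V₂} {h2b : ∀ u ∈ U₂, b u ∈ V₂}
    {n₁ n₂ : ℕ} {blk₁ : Fin n₁ → KBlock k} {e₁ : Fin n₁ → ℕ → U₁} {f₁ : Fin n₁ → ℕ → V₁}
    {blk₂ : Fin n₂ → KBlock k} {e₂ : Fin n₂ → ℕ → U₂} {f₂ : Fin n₂ → ℕ → V₂}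
    (D₁ : IsBlockDecomposition (restr a U₁ V₁ h1a) (restr b U₁ V₁ h1b) blk₁ e₁ f₁)
    (D₂ : IsBlockDecomposition (restr a U₂ V₂ h2a) (restr b U₂ V₂ h2b) blk₂ e₂ f₂) :
    IsBlockDecomposition a b (Fin.append blk₁ blk₂)
      (Fin.append (fun i r => (e₁ i r : U)) (fun i r => (e₂ i r : U)))
      (Fin.append (fun i c => (f₁ i c : V)) (fun i c => (f₂ i c : V))) := by
  refine ⟨?_, ?_, fun u => ?_, fun v => ?_, fun i => ?_, fun i => ?_⟩
  · rw [Fin.sum_univ_add]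
    simp only [Fin.append_left, Fin.append_right, D₁.rows_eq, D₂.rows_eq]
    exact Submodule.finrank_add_eq_of_isCompl hU
  · rw [Fin.sum_univ_add]
    simp only [Fin.append_left, Fin.append_right, D₁.cols_eq, D₂.cols_eq]
    exact Submodule.finrank_add_eq_of_isCompl hV
  · have hu : u ∈ U₁ ⊔ U₂ := by rw [codisjoint_iff.mp hU.codisjoint]; exact Submodule.mem_top
    obtain ⟨u₁, hu₁, u₂, hu₂, rfl⟩ := Submodule.mem_sup.mp hu
    obtain ⟨g₁, hg₁⟩ := D₁.span_e ⟨u₁, hu₁⟩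
    obtain ⟨g₂, hg₂⟩ := D₂.span_e ⟨u₂, hu₂⟩
    have hg₁' : u₁ = ∑ i, ∑ r ∈ Finset.range (blk₁ i).rows, g₁ i r • (e₁ i r : U) := by
      have := congrArg Subtype.val hg₁
      simpa [Submodule.coe_sum] using this
    have hg₂' : u₂ = ∑ i, ∑ r ∈ Finset.range (blk₂ i).rows, g₂ i r • (e₂ i r : U) := by
      have := congrArg Subtype.val hg₂
      simpa [Submodule.coe_sum] using this
    refine ⟨Fin.append g₁ g₂, ?_⟩
    rw [Fin.sum_univ_add]
    simp only [Fin.append_left, Fin.append_right]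
    rw [← hg₁', ← hg₂']
  · have hv : v ∈ V₁ ⊔ V₂ := by rw [codisjoint_iff.mp hV.codisjoint]; exact Submodule.mem_top
    obtain ⟨v₁, hv₁, v₂, hv₂, rfl⟩ := Submodule.mem_sup.mp hv
    obtain ⟨g₁, hg₁⟩ := D₁.span_f ⟨v₁, hv₁⟩
    obtain ⟨g₂, hg₂⟩ := D₂.span_f ⟨v₂, hv₂⟩
    have hg₁' : v₁ = ∑ i, ∑ c ∈ Finset.range (blk₁ i).cols, g₁ i c • (f₁ i c : V) := by
      have := congrArg Subtype.val hg₁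
      simpa [Submodule.coe_sum] using this
    have hg₂' : v₂ = ∑ i, ∑ c ∈ Finset.range (blk₂ i).cols, g₂ i c • (f₂ i c : V) := by
      have := congrArg Subtype.val hg₂
      simpa [Submodule.coe_sum] using this
    refine ⟨Fin.append g₁ g₂, ?_⟩
    rw [Fin.sum_univ_add]
    simp only [Fin.append_left, Fin.append_right]
    rw [← hg₁', ← hg₂']
  · induction i using Fin.addCases with
    | left i =>
        intro r hr
        simp only [Fin.append_left] at hr ⊢
        have := congrArg Subtype.val (D₁.rel_a i r hr)
        simpa [Submodule.coe_sum] using this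
    | right i =>
        intro r hr
        simp only [Fin.append_right] at hr ⊢
        have := congrArg Subtype.val (D₂.rel_a i r hr)
        simpa [Submodule.coe_sum] using this
  · induction i using Fin.addCases with
    | left i =>
        intro r hr
        simp only [Fin.append_left] at hr ⊢
        have := congrArg Subtype.val (D₁.rel_b i r hr)
        simpa [Submodule.coe_sum] using this
    | right i =>
        intro r hr
        simp only [Fin.append_right] at hr ⊢
        have := congrArg Subtype.val (D₂.rel_b i r hr)
        simpa [Submodule.coe_sum] using this

/-- **A single block.** An invariant pair `(U₁, V₁)` with vectors `u r ∈ U₁` (`r < rows`), `v c ∈ V₁` (`c < cols`) in the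
right number, spanning, and satisfying the relations of the block `blk`, is a one-block decomposition of `(U₁, V₁)`. -/
theorem single [FiniteDimensional k U] [FiniteDimensional k V] (blk : KBlock k) {U₁ : Submodule k U} {V₁ : Submodule k V}
    (ha : ∀ u ∈ U₁, a u ∈ V₁) (hb : ∀ u ∈ U₁, b u ∈ V₁) (u : ℕ → U) (v : ℕ → V)
    (hu : ∀ r < blk.rows, u r ∈ U₁) (hv : ∀ c < blk.cols, v c ∈ V₁)
    (hrows : blk.rows = finrank k U₁) (hcols : blk.cols = finrank k V₁)
    (hspan_u : ∀ x ∈ U₁, ∃ g : ℕ → k, x = ∑ r ∈ Finset.range blk.rows, g r • u r)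
    (hspan_v : ∀ y ∈ V₁, ∃ g : ℕ → k, y = ∑ c ∈ Finset.range blk.cols, g c • v c)
    (hrel_a : ∀ r < blk.rows, a (u r) = ∑ c ∈ Finset.range blk.cols, blk.A r c • v c)
    (hrel_b : ∀ r < blk.rows, b (u r) = ∑ c ∈ Finset.range blk.cols, blk.B r c • v c) :
    ∃ (e : Fin 1 → ℕ → U₁) (f : Fin 1 → ℕ → V₁), (∀ r < blk.rows, (e 0 r : U) = u r) ∧ (∀ c < blk.cols, (f 0 c : V) = v c) ∧
      IsBlockDecomposition (restr a U₁ V₁ ha) (restr b U₁ V₁ hb) (fun _ => blk) e f := by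
  classical
  let e : Fin 1 → ℕ → U₁ := fun _ r => if h : r < blk.rows then ⟨u r, hu r h⟩ else 0
  let f : Fin 1 → ℕ → V₁ := fun _ c => if h : c < blk.cols then ⟨v c, hv c h⟩ else 0
  have he : ∀ r < blk.rows, (e 0 r : U) = u r := fun r hr => by simp [e, hr]
  have hf : ∀ c < blk.cols, (f 0 c : V) = v c := fun c hc => by simp [f, hc]
  have hsumf : ∀ (g : ℕ → k), ((∑ c ∈ Finset.range blk.cols, g c • f 0 c : V₁) : V) =
      ∑ c ∈ Finset.range blk.cols, g c • v c := fun g => by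
    rw [Submodule.coe_sum]
    exact Finset.sum_congr rfl (fun c hc => by rw [Submodule.coe_smul, hf c (Finset.mem_range.mp hc)])
  refine ⟨e, f, he, hf, ⟨by simp [hrows], by simp [hcols], fun x => ?_, fun y => ?_, fun i r hr => ?_, fun i r hr => ?_⟩⟩
  · obtain ⟨g, hg⟩ := hspan_u x x.2
    refine ⟨fun _ => g, Subtype.ext ?_⟩
    rw [Fin.sum_univ_one (f := fun i : Fin 1 => ∑ r ∈ Finset.range blk.rows, g r • e i r), Submodule.coe_sum, hg]
    exact Finset.sum_congr rfl (fun r hr => by rw [Submodule.coe_smul, he r (Finset.mem_range.mp hr)])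
  · obtain ⟨g, hg⟩ := hspan_v y y.2
    refine ⟨fun _ => g, Subtype.ext ?_⟩
    rw [Fin.sum_univ_one (f := fun i : Fin 1 => ∑ c ∈ Finset.range blk.cols, g c • f i c), hsumf, hg]
  · apply Subtype.ext
    rw [Subsingleton.elim i 0, restr_apply, he r hr, hsumf, hrel_a r hr]
  · apply Subtype.ext
    rw [Subsingleton.elim i 0, restr_apply, he r hr, hsumf, hrel_b r hr]

end IsBlockDecomposition

end Summit.MatrixMultiplication.OmegaCensus.SmallFormats.Kronecker
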